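import Summits.KontsevichZagierPeriods.KontsevichZagierPeriods.Theorems.K2SymbolChainsFigureEightIsTwoSmythBaseMaps
import Summits.KontsevichZagierPeriods.KontsevichZagierPeriods.Theorems.K2SymbolChainsFigureEightIsTwoSmythMaps
import Summits.KontsevichZagierPeriods.KontsevichZagierPeriods.Theorems.K2SymbolChainsFigureEightIsTwoSmythReps

/-!
# `FigureEightIsTwoSmyth`, post-Jensen chain II: from the arc to the Smyth window (helper)

Item stmt-KontsevichZagierPeriods-5203 of route K2SymbolChains. The arc representation
`X = [{0 < t < 1/√3, 1 < u < L₊(t)²}, 2/((1+t²)(1+s²)u)]` (`θ ∈ (0, π/3)`; value `π·vol(4₁)`) is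
carried by the substitution `C = cos 2θ = 2c(t)² − 1` (rule 2) onto
`X_C = [{−1/2 < C < 1, 1 < u < Λ(C)}, 1/(2√(1−C²)(1+s²)u)]`, `Λ(C) = L₊(4C²−2C−4)²`, and `X_C` is
the image under the ALGEBRAIC substitution `C = Φ(x) = ¼ − ¼xR(x)`, `R = √((15−x²)/(1+x²))`,
`x = tan ψ ∈ (−√3, √3)` (rule 2) of

  `Y = [{−√3 < x < √3, 1 < u < 16/(1+x²)²}, (1 − x/R(x))/(2(1+x²)(1+s²)u)]`

(`exists_windowRep`: `[X] − [Y] ∈ S`). The transport identities (`Λ(Φ(x)) = 16/(1+x²)²`, the two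
Jacobian identities) are those of file `…Maps`; the base-map machinery is file `…BaseMaps`. The
even part of `Y` is half the Smyth band, the odd part integrates to zero (chain III).
[Kontsevich–Zagier 2001, §1.2, rule 2)] [folklore]
-/

noncomputable section

open MeasureTheory Set
open Literature.NumberTheory.Transcendental Literature.ModelTheory.ExponentialFields
open Summit.KontsevichZagierPeriods.K2SymbolChains.JensenIsScissorsProof

-- single-conjunct summit: Sub = Summit, so the namespace segment repeats by design (CONVENTIONS §2)
set_option linter.dupNamespace false

namespace Summit.KontsevichZagierPeriods.KontsevichZagierPeriods.Theorems

open Literature.NumberTheory.Transcendental.KZ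

variable {S : AddSubgroup FormalRep}

/-! ### Semialgebraic atoms -/

/-- A rational function `p/q` of the first base coordinate with `q ≠ 0` on `T` is `ℚ`-semialgebraic on
`T ⊆ ℝ²`. [BCR 1998, §2.2] [folklore] -/
theorem isSemialgebraicFunOn_ratFun_zero {T : Set (Fin 2 → ℝ)} (hT : IsSemialgebraic ℚ T)
    (p q : MvPolynomial (Fin 2) ℚ) (hq : ∀ b ∈ T, MvPolynomial.aeval b q ≠ 0) :
    IsSemialgebraicFunOn ℚ T fun b => MvPolynomial.aeval b p / MvPolynomial.aeval b q :=
  isSemialgebraicFunOn_aeval_div_aeval hT p q hq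

/-- `b ↦ C(b 0) = 2c(b 0)² − 1` is `ℚ`-semialgebraic. [BCR 1998, §2.2] [folklore] -/
theorem isSemialgebraicFunOn_cosTwo {T : Set (Fin 2 → ℝ)} (hT : IsSemialgebraic ℚ T) :
    IsSemialgebraicFunOn ℚ T fun b => 2 * ((1 - b 0 ^ 2) / (1 + b 0 ^ 2)) ^ 2 - 1 := by
  have hc := isSemialgebraicFunOn_ratCos hT 0
  have h2 : IsSemialgebraicFunOn ℚ T (fun _ => ((2 : ℚ) : ℝ)) := isSemialgebraicFunOn_ratCast hT 2
  have h1 : IsSemialgebraicFunOn ℚ T (fun _ => ((1 : ℚ) : ℝ)) := isSemialgebraicFunOn_ratCast hT 1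
  exact (IsSemialgebraicFunOn.sub_holds (IsSemialgebraicFunOn.mul_holds h2
    (IsSemialgebraicFunOn.mul_holds hc hc)) h1).congr fun b _ => by
      simp only [Pi.mul_apply, Pi.sub_apply]
      push_cast
      ring

/-- `b ↦ R(b 0) = √((15 − b 0²)/(1 + b 0²))` is `ℚ`-semialgebraic. [BCR 1998, §2.2] [folklore] -/
theorem isSemialgebraicFunOn_rootR {T : Set (Fin 2 → ℝ)} (hT : IsSemialgebraic ℚ T) :
    IsSemialgebraicFunOn ℚ T fun b => Real.sqrt ((15 - b 0 ^ 2) / (1 + b 0 ^ 2)) := by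
  have h := isSemialgebraicFunOn_aeval_div_aeval hT (15 - MvPolynomial.X 0 ^ 2) (1 + MvPolynomial.X 0 ^ 2)
    fun b _ => by
      have : (0 : ℝ) < 1 + b 0 ^ 2 := by positivity
      simpa using this.ne'
  exact (IsSemialgebraicFunOn.sqrt_holds h).congr fun b _ => by simp

/-- `b ↦ Φ(b 0) = ¼ − ¼ b 0 · R(b 0)` is `ℚ`-semialgebraic. [BCR 1998, §2.2] [folklore] -/
theorem isSemialgebraicFunOn_phiMap {T : Set (Fin 2 → ℝ)} (hT : IsSemialgebraic ℚ T) :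
    IsSemialgebraicFunOn ℚ T fun b => 1 / 4 - b 0 * Real.sqrt ((15 - b 0 ^ 2) / (1 + b 0 ^ 2)) / 4 := by
  have hR := isSemialgebraicFunOn_rootR hT
  have hx := isSemialgebraicFunOn_apply hT (0 : Fin 2)
  have hq : IsSemialgebraicFunOn ℚ T (fun _ => ((1 / 4 : ℚ) : ℝ)) := isSemialgebraicFunOn_ratCast hT (1 / 4)
  exact (IsSemialgebraicFunOn.sub_holds hq (IsSemialgebraicFunOn.mul_holds hq
    (IsSemialgebraicFunOn.mul_holds hx hR))).congr fun b _ => by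
      simp only [Pi.mul_apply, Pi.sub_apply]
      push_cast
      ring

/-- The integrand `1/(2√(1−C²)(1+s²)u)` of `X_C` is `ℚ`-semialgebraic on the band over `−1/2 < C < 1`.
[BCR 1998, §2.2] [folklore] -/
theorem isSemialgebraicFunOn_integrandXC {q : (Fin 2 → ℝ) → ℝ}
    (hq : IsSemialgebraicFunOn ℚ {b : Fin 2 → ℝ | b 0 ∈ Ioo (-1 / 2) 1} q) :
    IsSemialgebraicFunOn ℚ {z : Fin 3 → ℝ | Fin.init z ∈ {b : Fin 2 → ℝ | b 0 ∈ Ioo (-1 / 2) 1} ∧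
        1 < z (Fin.last 2) ∧ z (Fin.last 2) < q (Fin.init z)}
      fun z => 1 / (2 * Real.sqrt (1 - (Fin.init z) 0 ^ 2) * (1 + (Fin.init z) 1 ^ 2)) / z (Fin.last 2) := by
  set D := {z : Fin 3 → ℝ | Fin.init z ∈ {b : Fin 2 → ℝ | b 0 ∈ Ioo (-1 / 2) 1} ∧
        1 < z (Fin.last 2) ∧ z (Fin.last 2) < q (Fin.init z)} with hD
  have hB : IsSemialgebraic ℚ {b : Fin 2 → ℝ | b 0 ∈ Ioo (-1 / 2) 1} := by
    have h := (isSemialgebraic_fin_two_gt (-1 / 2)).inter (isSemialgebraic_fin_two_lt 1)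
    convert h using 1
    ext b
    simp only [mem_setOf_eq, mem_Ioo, mem_inter_iff]
    norm_num
  have hc1 : IsSemialgebraicFunOn ℚ {b : Fin 2 → ℝ | b 0 ∈ Ioo (-1 / 2) 1} (fun _ => (1 : ℝ)) := by
    simpa using isSemialgebraicFunOn_ratCast hB 1
  have hDs : IsSemialgebraic ℚ D := isSemialgebraic_oband hc1 hq
  have hsq : IsSemialgebraicFunOn ℚ {b : Fin 2 → ℝ | b 0 ∈ Ioo (-1 / 2) 1}
      (fun b => 2 * Real.sqrt (1 - b 0 ^ 2) * (1 + b 1 ^ 2)) := by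
    have hin := isSemialgebraicFunOn_aeval hB (1 - MvPolynomial.X 0 ^ 2)
    have hs := (IsSemialgebraicFunOn.sqrt_holds hin).congr (g := fun b => Real.sqrt (1 - b 0 ^ 2))
      fun b _ => by simp
    have h1 := isSemialgebraicFunOn_aeval hB (1 + MvPolynomial.X 1 ^ 2)
    have h2 : IsSemialgebraicFunOn ℚ _ (fun _ => ((2 : ℚ) : ℝ)) := isSemialgebraicFunOn_ratCast hB 2
    exact (IsSemialgebraicFunOn.mul_holds (IsSemialgebraicFunOn.mul_holds h2 hs) h1).congr
      fun b _ => by simp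
  have hden : IsSemialgebraicFunOn ℚ D (fun z => 2 * Real.sqrt (1 - (Fin.init z) 0 ^ 2) * (1 + (Fin.init z) 1 ^ 2)) :=
    hsq.comp_init.mono (fun z hz => hz.1) hDs
  have hden0 : ∀ z ∈ D, 2 * Real.sqrt (1 - (Fin.init z) 0 ^ 2) * (1 + (Fin.init z) 1 ^ 2) ≠ 0 := by
    intro z hz
    have hC : (Fin.init z) 0 ∈ Ioo (-1 / 2 : ℝ) 1 := hz.1
    have h1 : 0 < 1 - (Fin.init z) 0 ^ 2 := by nlinarith [hC.1, hC.2]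
    have h2 : 0 < Real.sqrt (1 - (Fin.init z) 0 ^ 2) := Real.sqrt_pos.2 h1
    positivity
  have hone : IsSemialgebraicFunOn ℚ D (fun _ => (1 : ℝ)) := by simpa using isSemialgebraicFunOn_ratCast hDs 1
  exact IsSemialgebraicFunOn.div (IsSemialgebraicFunOn.div hone hden hden0) (isSemialgebraicFunOn_apply hDs _)
    fun z hz => (one_pos.trans hz.2.1).ne'

/-- The integrand `(1 − x/R(x))/(2(1+x²)(1+s²)u)` of `Y` is `ℚ`-semialgebraic on the band over the
Smyth window. [BCR 1998, §2.2] [folklore] -/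
theorem isSemialgebraicFunOn_integrandY {q : (Fin 2 → ℝ) → ℝ}
    (hq : IsSemialgebraicFunOn ℚ {b : Fin 2 → ℝ | b 0 ∈ Ioo (-Real.sqrt 3) (Real.sqrt 3)} q) :
    IsSemialgebraicFunOn ℚ {z : Fin 3 → ℝ | Fin.init z ∈ {b : Fin 2 → ℝ | b 0 ∈ Ioo (-Real.sqrt 3) (Real.sqrt 3)} ∧
        1 < z (Fin.last 2) ∧ z (Fin.last 2) < q (Fin.init z)}
      fun z => (1 - (Fin.init z) 0 / Real.sqrt ((15 - (Fin.init z) 0 ^ 2) / (1 + (Fin.init z) 0 ^ 2))) /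
        (2 * (1 + (Fin.init z) 0 ^ 2) * (1 + (Fin.init z) 1 ^ 2)) / z (Fin.last 2) := by
  set B := {b : Fin 2 → ℝ | b 0 ∈ Ioo (-Real.sqrt 3) (Real.sqrt 3)} with hB_def
  set D := {z : Fin 3 → ℝ | Fin.init z ∈ B ∧ 1 < z (Fin.last 2) ∧ z (Fin.last 2) < q (Fin.init z)} with hD
  have hB : IsSemialgebraic ℚ B := isSemialgebraic_window
  have hc1 : IsSemialgebraicFunOn ℚ B (fun _ => (1 : ℝ)) := by simpa using isSemialgebraicFunOn_ratCast hB 1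
  have hDs : IsSemialgebraic ℚ D := isSemialgebraic_oband hc1 hq
  have hx3 : ∀ b ∈ B, b 0 ^ 2 < 3 := fun b hb => by
    have h : |b 0| < Real.sqrt 3 := abs_lt.2 hb
    have := (Real.lt_sqrt (abs_nonneg _)).1 h
    rwa [sq_abs] at this
  have hnum : IsSemialgebraicFunOn ℚ B
      (fun b => 1 - b 0 / Real.sqrt ((15 - b 0 ^ 2) / (1 + b 0 ^ 2))) :=
    IsSemialgebraicFunOn.sub_holds hc1 (IsSemialgebraicFunOn.div (isSemialgebraicFunOn_apply hB 0)
      (isSemialgebraicFunOn_rootR hB) fun b hb => (rootR_pos (by linarith [hx3 b hb])).ne')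
  have hdenB : IsSemialgebraicFunOn ℚ B (fun b => 2 * (1 + b 0 ^ 2) * (1 + b 1 ^ 2)) :=
    (isSemialgebraicFunOn_aeval hB (2 * (1 + MvPolynomial.X 0 ^ 2) * (1 + MvPolynomial.X 1 ^ 2))).congr
      fun b _ => by simp
  have hGB : IsSemialgebraicFunOn ℚ B (fun b => (1 - b 0 / Real.sqrt ((15 - b 0 ^ 2) / (1 + b 0 ^ 2))) /
      (2 * (1 + b 0 ^ 2) * (1 + b 1 ^ 2))) :=
    IsSemialgebraicFunOn.div hnum hdenB fun b _ => by positivity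
  exact IsSemialgebraicFunOn.div (hGB.comp_init.mono (fun z hz => hz.1) hDs) (isSemialgebraicFunOn_apply hDs _)
    fun z hz => (one_pos.trans hz.2.1).ne'

/-! ### The two substitutions -/

/-- **`[X] − [Y] ∈ S`: from the arc to the Smyth window.** For the arc representation
`X = [{0 < t < 1/√3, 1 < u < L₊(t)²}, 2/((1+t²)(1+s²)u)]` there is a representation
`Y = [{−√3 < x < √3, 1 < u < 16/(1+x²)²}, (1 − x/R(x))/(2(1+x²)(1+s²)u)]` with `[X] − [Y] ∈ S`:
`X` is carried onto `X_C = [{−1/2 < C < 1, 1 < u < Λ(C)}, 1/(2√(1−C²)(1+s²)u)]` by `C = 2c(t)² − 1`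
(rule 2), and `Y` is the preimage of `X_C` under `C = Φ(x)` (rule 2). [Kontsevich–Zagier 2001,
§1.2, rule 2)] [folklore] -/
theorem exists_windowRep (hS : domainAddRel ∪ integrandAddRel ∪ changeOfVariablesRel ⊆ S)
    (X : IntegralRep 3)
    (hX : X.domain = {z : Fin 3 → ℝ | Fin.init z ∈ {b : Fin 2 → ℝ | b 0 ∈ Ioo 0 (Real.sqrt 3)⁻¹} ∧
      1 < z (Fin.last 2) ∧ z (Fin.last 2) <
        ((16 * ((1 - (Fin.init z) 0 ^ 2) / (1 + (Fin.init z) 0 ^ 2)) ^ 4 -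
            20 * ((1 - (Fin.init z) 0 ^ 2) / (1 + (Fin.init z) 0 ^ 2)) ^ 2 + 2 -
          Real.sqrt ((16 * ((1 - (Fin.init z) 0 ^ 2) / (1 + (Fin.init z) 0 ^ 2)) ^ 4 -
            20 * ((1 - (Fin.init z) 0 ^ 2) / (1 + (Fin.init z) 0 ^ 2)) ^ 2 + 2) ^ 2 - 4)) / 2) ^ 2})
    (hXi : EqOn X.integrand (fun z => 2 / ((1 + (Fin.init z) 0 ^ 2) * (1 + (Fin.init z) 1 ^ 2)) /
      z (Fin.last 2)) X.domain) :
    ∃ Y : IntegralRep 3, Y.domain = {z : Fin 3 → ℝ | Fin.init z ∈ {b : Fin 2 → ℝ | b 0 ∈ Ioo (-Real.sqrt 3) (Real.sqrt 3)} ∧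
      1 < z (Fin.last 2) ∧ z (Fin.last 2) < 16 / (1 + (Fin.init z) 0 ^ 2) ^ 2} ∧
      Y.integrand = (fun z => (1 - (Fin.init z) 0 / Real.sqrt ((15 - (Fin.init z) 0 ^ 2) / (1 + (Fin.init z) 0 ^ 2))) /
        (2 * (1 + (Fin.init z) 0 ^ 2) * (1 + (Fin.init z) 1 ^ 2)) / z (Fin.last 2)) ∧
      of X - of Y ∈ S := by
  -- the fibre bounds
  set Λ : ℝ → ℝ := fun C => ((4 * C ^ 2 - 2 * C - 4 - Real.sqrt ((4 * C ^ 2 - 2 * C - 4) ^ 2 - 4)) / 2) ^ 2 with hΛ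
  set qC : (Fin 2 → ℝ) → ℝ := fun b => Λ (b 0) with hqC
  set qX : (Fin 2 → ℝ) → ℝ := fun b =>
    ((16 * ((1 - b 0 ^ 2) / (1 + b 0 ^ 2)) ^ 4 - 20 * ((1 - b 0 ^ 2) / (1 + b 0 ^ 2)) ^ 2 + 2 -
      Real.sqrt ((16 * ((1 - b 0 ^ 2) / (1 + b 0 ^ 2)) ^ 4 -
        20 * ((1 - b 0 ^ 2) / (1 + b 0 ^ 2)) ^ 2 + 2) ^ 2 - 4)) / 2) ^ 2 with hqX
  set qY : (Fin 2 → ℝ) → ℝ := fun b => 16 / (1 + b 0 ^ 2) ^ 2 with hqY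
  have hBC : IsSemialgebraic ℚ {b : Fin 2 → ℝ | b 0 ∈ Ioo (-1 / 2) 1} := by
    have h := (isSemialgebraic_fin_two_gt (-1 / 2)).inter (isSemialgebraic_fin_two_lt 1)
    convert h using 1
    ext b
    simp only [mem_setOf_eq, mem_Ioo, mem_inter_iff]
    norm_num
  have hqCs : IsSemialgebraicFunOn ℚ {b : Fin 2 → ℝ | b 0 ∈ Ioo (-1 / 2) 1} qC := by
    have hg := (isSemialgebraicFunOn_aeval hBC (4 * MvPolynomial.X 0 ^ 2 - 2 * MvPolynomial.X 0 - 4)).congr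
      (g := fun b : Fin 2 → ℝ => 4 * b 0 ^ 2 - 2 * b 0 - 4) fun b _ => by simp
    have h4 : IsSemialgebraicFunOn ℚ _ (fun _ => ((4 : ℚ) : ℝ)) := isSemialgebraicFunOn_ratCast hBC 4
    have h2 : IsSemialgebraicFunOn ℚ _ (fun _ => ((2 : ℚ) : ℝ)) := isSemialgebraicFunOn_ratCast hBC 2
    have hin : IsSemialgebraicFunOn ℚ _ (fun b : Fin 2 → ℝ => (4 * b 0 ^ 2 - 2 * b 0 - 4) ^ 2 - 4) :=
      (IsSemialgebraicFunOn.sub_holds (IsSemialgebraicFunOn.mul_holds hg hg) h4).congr fun b _ => by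
        simp only [Pi.mul_apply, Pi.sub_apply]
        push_cast
        ring
    have hs := IsSemialgebraicFunOn.sqrt_holds hin
    have hL := IsSemialgebraicFunOn.div (IsSemialgebraicFunOn.sub_holds hg hs) h2 (fun _ _ => by norm_num)
    exact (IsSemialgebraicFunOn.mul_holds hL hL).congr fun b _ => by
      simp only [hqC, hΛ, Pi.mul_apply, Pi.sub_apply]
      push_cast
      ring
  -- Step 1: `X ↦ X_C` by `C = 2c(t)² − 1`
  obtain ⟨ha0, ha1⟩ := inv_sqrt_three_pos_lt_one
  obtain ⟨XC, hXCd, hXCi, e₁⟩ := exists_image_baseMap hS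
    (φ := fun t : ℝ => 2 * ((1 - t ^ 2) / (1 + t ^ 2)) ^ 2 - 1)
    (φ' := fun t : ℝ => -(16 * t * (1 - t ^ 2) / (1 + t ^ 2) ^ 3))
    (I := Ioo 0 (Real.sqrt 3)⁻¹) (J := Ioo (-1 / 2) 1) isSemialgebraic_arc
    (isSemialgebraicFunOn_cosTwo isSemialgebraic_arc) (fun t _ => hasDerivAt_cosTwo t)
    ((strictAntiOn_cosTwo.injOn).mono fun t (ht : t ∈ Ioo (0:ℝ) (Real.sqrt 3)⁻¹) =>
      (⟨ht.1.le, (ht.2.trans ha1).le⟩ : t ∈ Icc (0:ℝ) 1))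
    image_cosTwo_Ioo (q := qX) (q' := qC)
    (fun b _ => by
      simp only [hqX, hqC, hΛ, Matrix.cons_val_zero, torusG_eq_of_cosTwo])
    X (by rw [hX]) (isSemialgebraicFunOn_integrandXC hqCs)
    (fun z hz => by
      have hz' := hz
      rw [hX] at hz'
      obtain ⟨⟨ht0, ht1⟩, hu, -⟩ := hz'
      have ht1' : (Fin.init z) 0 < 1 := ht1.trans ha1
      rw [hXi hz, abs_deriv_cosTwo ht0 ht1']
      simp only [Fin.init_snoc, Fin.snoc_last, Matrix.cons_val_zero, Matrix.cons_val_one]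
      have hsq := (Real.sqrt_pos.2 (one_sub_cosTwo_sq_pos ht0 ht1')).ne'
      have h1 : (1 + (Fin.init z) 0 ^ 2 : ℝ) ≠ 0 := by positivity
      have h2 : (1 + (Fin.init z) 1 ^ 2 : ℝ) ≠ 0 := by positivity
      have hu0 : z (Fin.last 2) ≠ 0 := (one_pos.trans hu).ne'
      set W := Real.sqrt (1 - (2 * ((1 - (Fin.init z) 0 ^ 2) / (1 + (Fin.init z) 0 ^ 2)) ^ 2 - 1) ^ 2) with hW
      clear_value W
      field_simp)
  -- Step 2: `Y` is the preimage of `X_C` under `C = Φ(x)`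
  have hqYs : IsSemialgebraicFunOn ℚ {b : Fin 2 → ℝ | b 0 ∈ Ioo (-Real.sqrt 3) (Real.sqrt 3)} qY :=
    (isSemialgebraicFunOn_aeval_div_aeval isSemialgebraic_window (MvPolynomial.C 16)
      ((1 + MvPolynomial.X 0 ^ 2) ^ 2) fun b _ => by
        have : (0 : ℝ) < (1 + b 0 ^ 2) ^ 2 := by positivity
        simpa using this.ne').congr fun b _ => by simp [hqY]
  have hx3 : ∀ x ∈ Ioo (-Real.sqrt 3) (Real.sqrt 3), x ^ 2 < 3 := fun x hx => by
    have h : |x| < Real.sqrt 3 := abs_lt.2 hx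
    have := (Real.lt_sqrt (abs_nonneg _)).1 h
    rwa [sq_abs] at this
  obtain ⟨Y, hYd, hYi, e₂⟩ := exists_preimage_baseMap hS
    (φ := fun x : ℝ => 1 / 4 - x * Real.sqrt ((15 - x ^ 2) / (1 + x ^ 2)) / 4)
    (φ' := fun x : ℝ => -((3 - x ^ 2) * (5 + x ^ 2)) / (4 * Real.sqrt ((15 - x ^ 2) / (1 + x ^ 2)) * (1 + x ^ 2) ^ 2))
    (I := Ioo (-Real.sqrt 3) (Real.sqrt 3)) (J := Ioo (-1 / 2) 1) isSemialgebraic_window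
    (isSemialgebraicFunOn_phiMap isSemialgebraic_window)
    (fun x hx => by
      have h := hasDerivAt_phiMap (show x ^ 2 < 15 by linarith [hx3 x hx])
      rwa [deriv_phiMap_eq (show x ^ 2 < 15 by linarith [hx3 x hx])] at h)
    (strictAntiOn_phiMap.injOn.mono Ioo_subset_Icc_self) image_phiMap_Ioo (q := qY) (q' := qC) hqYs
    (fun b hb => by
      have hb3 := hx3 _ hb
      simp only [hqY, hqC, hΛ, Matrix.cons_val_zero]
      rw [torusG_phiMap (show b 0 ^ 2 ≤ 15 by linarith), rootLp_sq_phiMap hb3])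
    XC hXCd
    (f := fun z => (1 - (Fin.init z) 0 / Real.sqrt ((15 - (Fin.init z) 0 ^ 2) / (1 + (Fin.init z) 0 ^ 2))) /
        (2 * (1 + (Fin.init z) 0 ^ 2) * (1 + (Fin.init z) 1 ^ 2)) / z (Fin.last 2))
    (isSemialgebraicFunOn_integrandY hqYs)
    (fun z hz => by
      obtain ⟨hxI, hu, -⟩ := hz
      have hx : (Fin.init z) 0 ^ 2 < 3 := hx3 _ hxI
      rw [hXCi, abs_deriv_phiMap hx]
      simp only [Fin.init_snoc, Fin.snoc_last, Matrix.cons_val_zero, Matrix.cons_val_one]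
      have hsq := (Real.sqrt_pos.2 (one_sub_phiMap_sq_pos hx)).ne'
      have hR := (rootR_pos (show (Fin.init z) 0 ^ 2 < 15 by linarith)).ne'
      have h1 : (1 + (Fin.init z) 0 ^ 2 : ℝ) ≠ 0 := by positivity
      have h2 : (1 + (Fin.init z) 1 ^ 2 : ℝ) ≠ 0 := by positivity
      have hu0 : z (Fin.last 2) ≠ 0 := (one_pos.trans hu).ne'
      set W := Real.sqrt (1 - (1 / 4 - (Fin.init z) 0 * Real.sqrt ((15 - (Fin.init z) 0 ^ 2) /
        (1 + (Fin.init z) 0 ^ 2)) / 4) ^ 2) with hW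
      clear_value W
      set R := Real.sqrt ((15 - (Fin.init z) 0 ^ 2) / (1 + (Fin.init z) 0 ^ 2)) with hRdef
      clear_value R
      field_simp)
  refine ⟨Y, ?_, hYi, ?_⟩
  · rw [hYd]
  · have : of X - of Y = (of X - of XC) - (of Y - of XC) := by abel
    rw [this]
    exact S.sub_mem e₁ e₂

end Summit.KontsevichZagierPeriods.KontsevichZagierPeriods.Theorems
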